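import Mathlib.RingTheory.Extension.Cotangent.LocalizationAway
import Mathlib.RingTheory.Smooth.Basic
import Mathlib.RingTheory.Unramified.Basic
import Mathlib.RingTheory.Localization.Ideal
import HarnessLib

/-!
# The splitting `J/J² ≅ W⁻¹S ⊗_S I/I² × K/K²` for a localization at an ARBITRARY multiplicative system
# (Hartshorne, *Deformation Theory*, §3, Ex. 3.5 — the cotangent-module input; [Stacks 08JZ (1)] beyond one denominator)

Layer `Literature/AlgebraicGeometry/Deformation` (family `hodge`; LT-H1 «semiregularity consumers», cell `pub-hsemireg`,
width seat lit-8 g12). PLAIN over Mathlib. Companion: `T1LocalizationSubmonoid` (same seat) turns this splitting into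
[Ex. 3.5] `T¹(W⁻¹S/R, N) ≅ T¹(S/R, N)`; the one-denominator case `S_g = S[y]/(g y − 1)` of both is Mathlib
`Mathlib.RingTheory.Extension.Cotangent.LocalizationAway` + tree `T1LocalizationAway` (lit-7 g10), whose
`-- TODO(general form): an arbitrary multiplicative system W ⊆ S` this pair of files closes.

[Hartshorne2010, §3, Ex. 3.5, p. 25 (held p0031:L1)]: «Localization. Show that the construction of the `T^i` functors is
compatible with localization …». The construction [Construction 3.1, pp. 18–19] runs on `L₁ = I/I²`, `L₀ = Ω_{R[x]/R} ⊗ S`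
for a presentation `R[x] ↠ S` with kernel `I`; compatibility with localization in degree `1` needs the comparison of
`I/I²`, `J/J²`, `K/K²` for the three presentations below, which is what is typed here.

SETTING. Rings `R → S`, a multiplicative system `W ⊆ S`, a localization `T = W⁻¹S` (Mathlib `IsLocalization W T`), a
polynomial presentation `P : R[x] ↠ S` with kernel `I` and ANY polynomial presentation `Q : S[y] ↠ T` with kernel `K`
(Mathlib `Algebra.Generators`); the composite `Q.comp P : R[x, y] ↠ T` has kernel `J`. Mathlib proves
`T ⊗_S I/I² → J/J² → K/K² → 0` exact (`Generators.Cotangent.exact`, `Cotangent.surjective_map_ofComp`) for any tower,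
and, for `T = S_g` with `Q = (S[y] ↠ S_g, y ↦ 1/g)` ONLY, injectivity on the left and the splitting
(`liftBaseChange_injective_of_isLocalizationAway`, `cotangentCompLocalizationAwayEquiv`, [Stacks 08JZ (1)]).

WHAT IS TYPED (general `W`, general `Q`).
* §1 **`T ⊗_S I/I² → J/J²` is INJECTIVE** (`liftBaseChange_injective_of_isLocalization`). Mathlib's argument
  run for a general `W`: the first-order thickening `R[x]/I²` with its reduction `thickeningToBase : R[x]/I² → S`
  (kernel `I/I²`, square zero: `ker_thickeningToBase_mul_self`), the preimage `W̃ = thickeningSubmonoid W P` of `W`,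
  and — for ANY localization `L` of `R[x]/I²` at `W̃` — the maps `thickeningLocalizationToLocalization : L → T`
  (kernel inside `(I/I²)·L`, `ker_thickeningLocalizationToLocalization_le`, an ideal whose elements multiply to `0`,
  `mul_eq_zero_of_mem_map_ker_thickeningToBase`) and `compThickeningRingHom π : R[x, y] → L` (`x_i ↦ [x_i]`, `y_j ↦`
  a lift `thickeningLift` of `Q(y_j)`); `π(J) ⊆ ker(L → T)` hence `π(J²) = 0` (`sq_ker_comp_le_ker_compThickeningRingHom`);
  so `i ∈ I ∩ J²` gives `[i]/1 = 0` in `W̃⁻¹(R[x]/I²)`, i.e. `w·ī = 0` in `I/I²` for some `w ∈ W`.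
* §2 **`K/K²` is FREE**: `W⁻¹S` is formally smooth and formally unramified over `S` (Mathlib
  `FormallySmooth.of_isLocalization`, `FormallyUnramified.of_isLocalization`), so `d₁ : K/K² → Ω_{S[y]/S} ⊗ T` is
  injective (Mathlib `Extension.cotangentComplex_injective_iff`, [Thm. 4.9]) and onto (cokernel `Ω_{T/S} = 0`):
  `cotangentComplex_bijective_of_isLocalization`, `cotangentEquivCotangentSpaceOfIsLocalization`, and the
  basis `cotangentBasisOfIsLocalization` of `K/K²` indexed by the variables `y` (pull-back of `Q.cotangentSpaceBasis`).
* §3 **the splitting**: a section `cotangentCompSecOfIsLocalization : K/K² → J/J²` (defined on the basis), and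
  **`cotangentCompEquivOfIsLocalization : J/J² ≃ₗ[T] T ⊗_S I/I² × K/K²`** (Mathlib `Function.Exact.splitSurjectiveEquiv`)
  with its characterising identities `_symm_inl`, `snd_comp_`, `_map_toComp` (`I/I² → J/J²` is `x ↦ (1 ⊗ x, 0)`).

Hypotheses vs print: none added — [Ex. 3.5] asks for arbitrary localizations; Mathlib's one-denominator hypothesis
`IsLocalization.Away g T` is replaced by `IsLocalization W T` and the fixed presentation `y ↦ 1/g` by an arbitrary `Q`.
Everything PROVED: `def`s (data: the thickening maps, lifts, the section, the basis, the splitting) and theorems; no named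
fact (net debt 0), no `sorry`, no `instance`, no notation. Grade: REFEREED ([Stacks 08JZ (1)] states the split exact
sequence for `S → S_g`; the general-`W` form is the same argument). Nothing here asserts HC ∕ HC_CM ∕ HC_AV or any
semiregularity statement.

## References

* [Hartshorne2010] R. Hartshorne, *Deformation Theory*, GTM 257, Springer 2010: §3, Ex. 3.5 (p. 25, held p0031:L1);
  Construction 3.1 (pp. 18–19); Thm. 4.9 (§4).
* [StacksProject] The Stacks Project, Tag 08JZ (1) (split exact `0 → T ⊗_S I/I² → J/J² → K/K² → 0` for a localization;
  Mathlib `Mathlib.RingTheory.Extension.Cotangent.LocalizationAway`), Tag 031I (formal smoothness ⟺ split injectivity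
  of `K/K² → Ω ⊗ T`; Mathlib `Algebra.Extension.cotangentComplex_injective_iff`).
* Mathlib: `Mathlib.RingTheory.Kaehler.JacobiZariski` (`Generators.Cotangent.exact`, `Cotangent.surjective_map_ofComp`),
  `Mathlib.RingTheory.Smooth.Basic`, `Mathlib.RingTheory.Unramified.Basic`, `Mathlib.RingTheory.Localization.Ideal`.
-/

noncomputable section

open TensorProduct MvPolynomial

namespace Literature.AlgebraicGeometry.Deformation.LichtenbaumSchlessinger

open Algebra Algebra.Extension

/-! ## §1 The first-order thickening `W̃⁻¹(R[x]/I²)` and the injectivity of `W⁻¹S ⊗_S I/I² → J/J²` -/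

section Thickening

variable {R S T : Type*} [CommRing R] [CommRing S] [CommRing T] [Algebra R S] [Algebra S T]
variable (W : Submonoid S) [IsLocalization W T]
variable {ι ι' : Type*} (Q : Algebra.Generators S T ι') (P : Algebra.Generators R S ι)

/-- **The reduction `R[x]/I² → S` of the first-order thickening of `Spec S` in `Spec R[x]`** (the presentation
`P : R[x] ↠ S` has kernel `I ⊇ I²`). [cite: Hartshorne2010, Ex. 3.5, p. 25] -/
def thickeningToBase : (P.Ring ⧸ P.ker ^ 2) →ₐ[R] S :=
  Ideal.Quotient.liftₐ (P.ker ^ 2) (IsScalarTower.toAlgHom R P.Ring S) fun a ha =>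
    (RingHom.mem_ker.1 (P.ker_eq_ker_aeval_val ▸ Ideal.pow_le_self two_ne_zero ha) :
      aeval P.val a = 0) ▸ (P.algebraMap_apply a).symm ▸ rfl

/-- [cite: Hartshorne2010, Ex. 3.5, p. 25] -/
@[simp]
theorem thickeningToBase_mk (a : P.Ring) :
    thickeningToBase P (Ideal.Quotient.mk (P.ker ^ 2) a) = algebraMap P.Ring S a :=
  rfl

/-- [cite: Hartshorne2010, Ex. 3.5, p. 25] -/
theorem thickeningToBase_surjective : Function.Surjective (thickeningToBase P) := fun s =>
  ⟨Ideal.Quotient.mk _ (P.σ s), by rw [thickeningToBase_mk, Generators.algebraMap_apply, P.aeval_val_σ]⟩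

/-- The kernel of `R[x]/I² → S` (namely `I/I²`) has square zero. [cite: Hartshorne2010, Ex. 3.5, p. 25] -/
theorem ker_thickeningToBase_mul_self :
    RingHom.ker (thickeningToBase P) * RingHom.ker (thickeningToBase P) = ⊥ := by
  rw [← le_bot_iff, Ideal.mul_le]
  intro a ha b hb
  obtain ⟨a, rfl⟩ := Ideal.Quotient.mk_surjective a
  obtain ⟨b, rfl⟩ := Ideal.Quotient.mk_surjective b
  rw [RingHom.mem_ker, thickeningToBase_mk, Generators.algebraMap_apply] at ha hb
  rw [← map_mul, Ideal.mem_bot, Ideal.Quotient.eq_zero_iff_mem, sq]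
  exact Ideal.mul_mem_mul (P.ker_eq_ker_aeval_val ▸ ha) (P.ker_eq_ker_aeval_val ▸ hb)

/-- **The preimage `W̃ ⊆ R[x]/I²` of the multiplicative system `W ⊆ S`.** [cite: Hartshorne2010, Ex. 3.5, p. 25] -/
def thickeningSubmonoid : Submonoid (P.Ring ⧸ P.ker ^ 2) :=
  W.comap (thickeningToBase P)

/-- [cite: Hartshorne2010, Ex. 3.5, p. 25] -/
theorem mem_thickeningSubmonoid_iff (a : P.Ring ⧸ P.ker ^ 2) :
    a ∈ thickeningSubmonoid W P ↔ thickeningToBase P a ∈ W :=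
  Iff.rfl

/-- `W̃ → W` is onto. [cite: Hartshorne2010, Ex. 3.5, p. 25] -/
theorem exists_thickeningSubmonoid_eq (w : W) :
    ∃ m : thickeningSubmonoid W P, thickeningToBase P m = w := by
  obtain ⟨a, ha⟩ := thickeningToBase_surjective P w
  exact ⟨⟨a, by rw [mem_thickeningSubmonoid_iff, ha]; exact w.2⟩, ha⟩

variable (L : Type*) [CommRing L] [Algebra (P.Ring ⧸ P.ker ^ 2) L] [IsLocalization (thickeningSubmonoid W P) L]

variable (T) in
/-- **`W̃⁻¹(R[x]/I²) → W⁻¹S`**, the localization of the reduction `R[x]/I² → S` (elements of `W̃` become units in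
`W⁻¹S`). [cite: Hartshorne2010, Ex. 3.5, p. 25] -/
def thickeningLocalizationToLocalization : L →+* T :=
  IsLocalization.lift (M := thickeningSubmonoid W P) (S := L)
    (g := (algebraMap S T).comp (thickeningToBase P).toRingHom) fun m =>
    IsLocalization.map_units T ⟨thickeningToBase P m, m.2⟩

/-- [cite: Hartshorne2010, Ex. 3.5, p. 25] -/
@[simp]
theorem thickeningLocalizationToLocalization_algebraMap (a : P.Ring ⧸ P.ker ^ 2) :
    thickeningLocalizationToLocalization T W P L (algebraMap (P.Ring ⧸ P.ker ^ 2) L a) =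
      algebraMap S T (thickeningToBase P a) := by
  rw [thickeningLocalizationToLocalization, IsLocalization.lift_eq]
  rfl

/-- **`ker(W̃⁻¹(R[x]/I²) → W⁻¹S) ⊆ (I/I²)·W̃⁻¹(R[x]/I²)`** (localization is exact: if `a/m ↦ 0` then `w·ā = 0` in `S`
for some `w ∈ W`, `w = θ(m₁)`, and `a/m = (m₁ a)/(m₁ m)` with `m₁ a ∈ I/I²`). [cite: Hartshorne2010, Ex. 3.5, p. 25] -/
theorem ker_thickeningLocalizationToLocalization_le :
    RingHom.ker (thickeningLocalizationToLocalization T W P L) ≤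
      (RingHom.ker (thickeningToBase P)).map (algebraMap (P.Ring ⧸ P.ker ^ 2) L) := by
  intro z hz
  obtain ⟨⟨a, m⟩, rfl⟩ := IsLocalization.mk'_surjective (thickeningSubmonoid W P) z
  have h0 : algebraMap S T (thickeningToBase P a) = 0 := by
    rw [← thickeningLocalizationToLocalization_algebraMap W P L a, ← IsLocalization.mk'_spec L a m, map_mul,
      RingHom.mem_ker.1 hz, zero_mul]
  obtain ⟨w, hw⟩ := (IsLocalization.map_eq_zero_iff W T _).1 h0
  obtain ⟨m₁, hm₁⟩ := exists_thickeningSubmonoid_eq W P w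
  rw [IsLocalization.mem_map_algebraMap_iff (thickeningSubmonoid W P) L]
  refine ⟨⟨⟨(m₁ : P.Ring ⧸ P.ker ^ 2) * a, ?_⟩, m₁ * m⟩, ?_⟩
  · rw [RingHom.mem_ker, map_mul, hm₁, hw]
  · simp only [Submonoid.coe_mul, map_mul]
    rw [← IsLocalization.mk'_spec L a m]
    ring

include W in
/-- **The ideal `(I/I²)·W̃⁻¹(R[x]/I²)` has square zero**: products of two of its elements vanish (clear denominators
into `I/I² · I/I² = 0`). [cite: Hartshorne2010, Ex. 3.5, p. 25] -/
theorem mul_eq_zero_of_mem_map_ker_thickeningToBase {u v : L}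
    (hu : u ∈ (RingHom.ker (thickeningToBase P)).map (algebraMap (P.Ring ⧸ P.ker ^ 2) L))
    (hv : v ∈ (RingHom.ker (thickeningToBase P)).map (algebraMap (P.Ring ⧸ P.ker ^ 2) L)) :
    u * v = 0 := by
  rw [IsLocalization.mem_map_algebraMap_iff (thickeningSubmonoid W P) L] at hu hv
  obtain ⟨⟨⟨k₁, hk₁⟩, m₁⟩, h₁⟩ := hu
  obtain ⟨⟨⟨k₂, hk₂⟩, m₂⟩, h₂⟩ := hv
  have hk : k₁ * k₂ = 0 := Ideal.mem_bot.1 ((ker_thickeningToBase_mul_self P).le (Ideal.mul_mem_mul hk₁ hk₂))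
  have h : u * v * algebraMap (P.Ring ⧸ P.ker ^ 2) L ((m₁ * m₂ : thickeningSubmonoid W P) : P.Ring ⧸ P.ker ^ 2) = 0 := by
    rw [Submonoid.coe_mul, map_mul, mul_mul_mul_comm, h₁, h₂, ← map_mul, hk, map_zero]
  exact (IsLocalization.map_units L (m₁ * m₂)).mul_left_eq_zero.1 h

/-- A denominator in `W̃` for `t ∈ W⁻¹S`: with `t · w = s` (`IsLocalization.sec`), the class of `σ(w)`.
[cite: Hartshorne2010, Ex. 3.5, p. 25] -/
def thickeningDen (t : T) : thickeningSubmonoid W P :=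
  ⟨Ideal.Quotient.mk _ (P.σ (IsLocalization.sec W t).2), by
    rw [mem_thickeningSubmonoid_iff, thickeningToBase_mk, Generators.algebraMap_apply, P.aeval_val_σ]
    exact (IsLocalization.sec W t).2.2⟩

/-- A lift of `t ∈ W⁻¹S` to `W̃⁻¹(R[x]/I²)`: `[σ(s)]/[σ(w)]` for `t · w = s`. [cite: Hartshorne2010, Ex. 3.5, p. 25] -/
def thickeningLift (t : T) : L :=
  IsLocalization.mk' L (Ideal.Quotient.mk (P.ker ^ 2) (P.σ (IsLocalization.sec W t).1)) (thickeningDen W P t)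

/-- [cite: Hartshorne2010, Ex. 3.5, p. 25] -/
@[simp]
theorem thickeningLocalizationToLocalization_thickeningLift (t : T) :
    thickeningLocalizationToLocalization T W P L (thickeningLift W P L t) = t := by
  rw [thickeningLift, thickeningLocalizationToLocalization, IsLocalization.lift_mk'_spec]
  simp only [RingHom.coe_comp, Function.comp_apply, AlgHom.toRingHom_eq_coe, AlgHom.coe_toRingHom, thickeningDen,
    thickeningToBase_mk, Generators.algebraMap_apply, Generators.aeval_val_σ]
  rw [mul_comm, IsLocalization.sec_spec]

variable [Algebra R T] [IsScalarTower R S T]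

/-- **`π : R[x, y] → W̃⁻¹(R[x]/I²)`**: `x_i ↦ [x_i]`, `y_j ↦` the chosen lift of `Q(y_j)`, constants along
`R → R[x]/I² → W̃⁻¹(R[x]/I²)`. [cite: Hartshorne2010, Ex. 3.5, p. 25] -/
def compThickeningRingHom : (Q.comp P).Ring →+* L :=
  eval₂Hom ((algebraMap (P.Ring ⧸ P.ker ^ 2) L).comp (algebraMap R (P.Ring ⧸ P.ker ^ 2)))
    (Sum.elim (fun j => thickeningLift W P L (Q.val j)) fun i =>
      algebraMap (P.Ring ⧸ P.ker ^ 2) L (Ideal.Quotient.mk (P.ker ^ 2) (X i)))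

/-- `π` restricted to `R[x]` is `R[x] → R[x]/I² → W̃⁻¹(R[x]/I²)`. [cite: Hartshorne2010, Ex. 3.5, p. 25] -/
theorem compThickeningRingHom_toComp (p : P.Ring) :
    compThickeningRingHom W Q P L ((Q.toComp P).toAlgHom p) =
      algebraMap (P.Ring ⧸ P.ker ^ 2) L (Ideal.Quotient.mk (P.ker ^ 2) p) := by
  have h : (compThickeningRingHom W Q P L).comp (Q.toComp P).toAlgHom.toRingHom =
      (algebraMap (P.Ring ⧸ P.ker ^ 2) L).comp (Ideal.Quotient.mk (P.ker ^ 2)) := by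
    refine MvPolynomial.ringHom_ext (fun r => ?_) (fun i => ?_)
    · rw [RingHom.comp_apply, RingHom.comp_apply, AlgHom.toRingHom_eq_coe, AlgHom.coe_toRingHom,
        Generators.toComp_toAlgHom, rename_C, compThickeningRingHom, eval₂Hom_C, RingHom.comp_apply,
        ← Ideal.Quotient.mk_algebraMap, MvPolynomial.algebraMap_eq]
    · rw [RingHom.comp_apply, RingHom.comp_apply, AlgHom.toRingHom_eq_coe, AlgHom.coe_toRingHom,
        Generators.toComp_toAlgHom, rename_X, compThickeningRingHom, eval₂Hom_X', Sum.elim_inr]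
  exact RingHom.congr_fun h p

/-- `π` followed by `W̃⁻¹(R[x]/I²) → W⁻¹S` is the structure map `R[x, y] ↠ W⁻¹S`.
[cite: Hartshorne2010, Ex. 3.5, p. 25] -/
theorem thickeningLocalizationToLocalization_comp_compThickeningRingHom :
    (thickeningLocalizationToLocalization T W P L).comp (compThickeningRingHom W Q P L) =
      algebraMap (Q.comp P).Ring T := by
  refine MvPolynomial.ringHom_ext (fun r => ?_) (fun k => ?_)
  · rw [RingHom.comp_apply, compThickeningRingHom, eval₂Hom_C, RingHom.comp_apply,
      thickeningLocalizationToLocalization_algebraMap, AlgHom.commutes, ← IsScalarTower.algebraMap_apply,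
      Generators.algebraMap_apply, MvPolynomial.algHom_C]
  · rw [RingHom.comp_apply, compThickeningRingHom, eval₂Hom_X', Generators.algebraMap_apply, aeval_X,
      Generators.comp_val]
    rcases k with j | i
    · rw [Sum.elim_inl, Sum.elim_inl, thickeningLocalizationToLocalization_thickeningLift]
    · rw [Sum.elim_inr, Sum.elim_inr, thickeningLocalizationToLocalization_algebraMap, thickeningToBase_mk,
        Generators.algebraMap_apply, aeval_X, Function.comp_apply]

/-- `π(J) ⊆ ker(W̃⁻¹(R[x]/I²) → W⁻¹S)`. [cite: Hartshorne2010, Ex. 3.5, p. 25] -/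
theorem ker_comp_le_comap_compThickeningRingHom :
    (Q.comp P).ker ≤ Ideal.comap (compThickeningRingHom W Q P L)
      (RingHom.ker (thickeningLocalizationToLocalization T W P L)) := by
  intro p hp
  rw [Ideal.mem_comap, RingHom.mem_ker, ← RingHom.comp_apply,
    thickeningLocalizationToLocalization_comp_compThickeningRingHom, Generators.algebraMap_apply]
  exact Generators.aeval_val_eq_zero hp

/-- **`π(J²) = 0`** (`π(J)` lies in the square-zero ideal `(I/I²)·W̃⁻¹(R[x]/I²)`). [cite: Hartshorne2010, Ex. 3.5, p. 25] -/
theorem sq_ker_comp_le_ker_compThickeningRingHom :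
    (Q.comp P).ker ^ 2 ≤ RingHom.ker (compThickeningRingHom W Q P L) := by
  rw [sq (Q.comp P).ker, Ideal.mul_le]
  intro p hp q hq
  have hp' := ker_thickeningLocalizationToLocalization_le W P L
    (Ideal.mem_comap.1 (ker_comp_le_comap_compThickeningRingHom W Q P L hp))
  have hq' := ker_thickeningLocalizationToLocalization_le W P L
    (Ideal.mem_comap.1 (ker_comp_le_comap_compThickeningRingHom W Q P L hq))
  rw [RingHom.mem_ker, map_mul]
  exact mul_eq_zero_of_mem_map_ker_thickeningToBase W P L hp' hq'

include W in
/-- **[Stacks 08JZ (1)] for an arbitrary multiplicative system: `W⁻¹S ⊗_S I/I² → J/J²` is injective**, for ANY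
polynomial presentation `Q` of `W⁻¹S` over `S` (if `i ∈ I` lies in `J²`, then `π(i) = [i]/1 = 0` in `W̃⁻¹(R[x]/I²)`,
so `m·[i] = 0` for some `m ∈ W̃`, i.e. `w·ī = 0` in `I/I²` with `w = θ(m) ∈ W`).
[cite: Hartshorne2010, Ex. 3.5, p. 25] -/
theorem liftBaseChange_injective_of_isLocalization :
    Function.Injective (LinearMap.liftBaseChange T
      (Extension.Cotangent.map (Q.toComp P).toExtensionHom)) := by
  refine IsLocalizedModule.injective_of_map_zero W (TensorProduct.mk S T P.toExtension.Cotangent 1)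
    (fun x hx => ?_)
  obtain ⟨x, rfl⟩ := Extension.Cotangent.mk_surjective x
  have h1 : (Q.toComp P).toAlgHom x.1 ∈ (Q.comp P).ker ^ 2 := by
    simpa only [LinearEquiv.coe_coe, LinearMap.ringLmapEquivSelf_symm_apply, TensorProduct.mk_apply,
      TensorProduct.lift.tmul, LinearMap.coe_restrictScalars, LinearMap.coe_smulRight, Module.End.one_apply,
      LinearMap.smul_apply, one_smul, Extension.Cotangent.map_mk, Extension.Cotangent.mk_eq_zero_iff] using! hx
  have h2 := sq_ker_comp_le_ker_compThickeningRingHom W Q P (Localization (thickeningSubmonoid W P)) h1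
  rw [RingHom.mem_ker, compThickeningRingHom_toComp,
    IsLocalization.map_eq_zero_iff (thickeningSubmonoid W P) (Localization (thickeningSubmonoid W P))] at h2
  obtain ⟨⟨m, hm⟩, hmx⟩ := h2
  obtain ⟨m, rfl⟩ := Ideal.Quotient.mk_surjective m
  rw [← map_mul, Ideal.Quotient.eq_zero_iff_mem] at hmx
  rw [mem_thickeningSubmonoid_iff, thickeningToBase_mk] at hm
  rw [IsLocalizedModule.eq_zero_iff W (TensorProduct.mk S T P.toExtension.Cotangent 1)]
  refine ⟨⟨algebraMap P.Ring S m, hm⟩, ?_⟩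
  change (algebraMap P.toExtension.Ring S m) • Extension.Cotangent.mk x = 0
  rw [algebraMap_smul, ← map_smul, Extension.Cotangent.mk_eq_zero_iff, Submodule.coe_smul, smul_eq_mul]
  exact hmx

end Thickening

/-! ## §2 `K/K²` of a polynomial presentation of a localization is free: `K/K² ≅ L₀(W⁻¹S/S) = ⊕_j W⁻¹S·dy_j` -/

section Etale

variable {S T : Type*} [CommRing S] [CommRing T] [Algebra S T]
variable (W : Submonoid S) [IsLocalization W T]
variable {ι' : Type*} (Q : Algebra.Generators S T ι')

include W in
/-- **`d₁ : K/K² → Ω_{S[y]/S} ⊗ W⁻¹S` is bijective** for any polynomial presentation `S[y] ↠ W⁻¹S` with kernel `K`: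
injective because `W⁻¹S` is formally smooth over `S` ([Thm. 4.9]; Mathlib `cotangentComplex_injective_iff`), onto
because its cokernel `Ω_{W⁻¹S/S}` vanishes. [cite: Hartshorne2010, Ex. 3.5, p. 25; Thm. 4.9, §4] -/
theorem cotangentComplex_bijective_of_isLocalization :
    Function.Bijective Q.toExtension.cotangentComplex := by
  haveI : Algebra.FormallySmooth S T := Algebra.FormallySmooth.of_isLocalization (Rₘ := T) W
  haveI : Algebra.FormallyUnramified S T := Algebra.FormallyUnramified.of_isLocalization W
  haveI : Algebra.FormallySmooth S Q.toExtension.Ring :=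
    inferInstanceAs (Algebra.FormallySmooth S (MvPolynomial ι' S))
  refine ⟨(Extension.cotangentComplex_injective_iff Q.toExtension).2 inferInstance, fun y => ?_⟩
  exact (Q.toExtension.exact_cotangentComplex_toKaehler y).1 (Subsingleton.elim _ _)

/-- **`K/K² ≅ L₀(W⁻¹S/S)`** as `W⁻¹S`-modules. [cite: Hartshorne2010, Ex. 3.5, p. 25; Thm. 4.9, §4] -/
def cotangentEquivCotangentSpaceOfIsLocalization :
    Q.toExtension.Cotangent ≃ₗ[T] Q.toExtension.CotangentSpace :=
  LinearEquiv.ofBijective _ (cotangentComplex_bijective_of_isLocalization W Q)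

/-- [cite: Hartshorne2010, Ex. 3.5, p. 25] -/
@[simp]
theorem cotangentEquivCotangentSpaceOfIsLocalization_apply (x : Q.toExtension.Cotangent) :
    cotangentEquivCotangentSpaceOfIsLocalization W Q x = Q.toExtension.cotangentComplex x :=
  rfl

/-- **`K/K²` is free on the classes corresponding to `dy_j`** (the basis `Q.cotangentSpaceBasis` of `L₀` pulled back).
[cite: Hartshorne2010, Ex. 3.5, p. 25] -/
def cotangentBasisOfIsLocalization : Module.Basis ι' T Q.toExtension.Cotangent :=
  Q.cotangentSpaceBasis.map (cotangentEquivCotangentSpaceOfIsLocalization W Q).symm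

end Etale

/-! ## §3 The splitting `J/J² ≅ W⁻¹S ⊗_S I/I² × K/K²` -/

section Splitting

variable {R S T : Type*} [CommRing R] [CommRing S] [CommRing T]
variable [Algebra R S] [Algebra S T] [Algebra R T] [IsScalarTower R S T]
variable (W : Submonoid S) [IsLocalization W T]
variable {ι ι' : Type*} (Q : Algebra.Generators S T ι') (P : Algebra.Generators R S ι)

/-- **A section `K/K² → J/J²` of `J/J² ↠ K/K²`**, defined on the basis of `K/K²` by choosing preimages (Mathlib
`Generators.Cotangent.surjective_map_ofComp`). [cite: Hartshorne2010, Ex. 3.5, p. 25] -/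
def cotangentCompSecOfIsLocalization :
    Q.toExtension.Cotangent →ₗ[T] (Q.comp P).toExtension.Cotangent :=
  (cotangentBasisOfIsLocalization W Q).constr T fun j =>
    (Generators.Cotangent.surjective_map_ofComp Q P (cotangentBasisOfIsLocalization W Q j)).choose

/-- [cite: Hartshorne2010, Ex. 3.5, p. 25] -/
theorem map_ofComp_cotangentCompSecOfIsLocalization_basis (j : ι') :
    Extension.Cotangent.map (Q.ofComp P).toExtensionHom
        (cotangentCompSecOfIsLocalization W Q P (cotangentBasisOfIsLocalization W Q j)) =
      cotangentBasisOfIsLocalization W Q j := by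
  rw [cotangentCompSecOfIsLocalization, Module.Basis.constr_basis]
  exact (Generators.Cotangent.surjective_map_ofComp Q P (cotangentBasisOfIsLocalization W Q j)).choose_spec

/-- The section property `(J/J² → K/K²) ∘ s = id`. [cite: Hartshorne2010, Ex. 3.5, p. 25] -/
theorem map_ofComp_comp_cotangentCompSecOfIsLocalization :
    Extension.Cotangent.map (Q.ofComp P).toExtensionHom ∘ₗ cotangentCompSecOfIsLocalization W Q P = .id :=
  (cotangentBasisOfIsLocalization W Q).ext fun j => by
    rw [LinearMap.comp_apply, map_ofComp_cotangentCompSecOfIsLocalization_basis, LinearMap.id_apply]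

/-- **[Stacks 08JZ (1)] for an arbitrary multiplicative system: `J/J² ≃ W⁻¹S ⊗_S (I/I²) × K/K²`** — the exact
`W⁻¹S ⊗_S I/I² → J/J² → K/K² → 0` (Mathlib `Generators.Cotangent.exact`) is injective on the left (§1) and split by
the section of §2–§3. [cite: Hartshorne2010, Ex. 3.5, p. 25] -/
def cotangentCompEquivOfIsLocalization :
    (Q.comp P).toExtension.Cotangent ≃ₗ[T] T ⊗[S] P.toExtension.Cotangent × Q.toExtension.Cotangent :=
  ((Generators.Cotangent.exact Q P).splitSurjectiveEquiv
    (liftBaseChange_injective_of_isLocalization W Q P)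
    ⟨cotangentCompSecOfIsLocalization W Q P, map_ofComp_comp_cotangentCompSecOfIsLocalization W Q P⟩).1

/-- Under the splitting, `W⁻¹S ⊗_S I/I² → J/J²` is the inclusion of the first factor.
[cite: Hartshorne2010, Ex. 3.5, p. 25] -/
theorem cotangentCompEquivOfIsLocalization_symm_comp_inl :
    (cotangentCompEquivOfIsLocalization W Q P).symm.toLinearMap ∘ₗ
        LinearMap.inl T (T ⊗[S] P.toExtension.Cotangent) Q.toExtension.Cotangent =
      LinearMap.liftBaseChange T (Extension.Cotangent.map (Q.toComp P).toExtensionHom) :=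
  ((Generators.Cotangent.exact Q P).splitSurjectiveEquiv
    (liftBaseChange_injective_of_isLocalization W Q P)
    ⟨cotangentCompSecOfIsLocalization W Q P, map_ofComp_comp_cotangentCompSecOfIsLocalization W Q P⟩).2.1.symm

/-- [cite: Hartshorne2010, Ex. 3.5, p. 25] -/
@[simp]
theorem cotangentCompEquivOfIsLocalization_symm_inl (a : T ⊗[S] P.toExtension.Cotangent) :
    (cotangentCompEquivOfIsLocalization W Q P).symm (a, 0) =
      LinearMap.liftBaseChange T (Extension.Cotangent.map (Q.toComp P).toExtensionHom) a := by
  rw [← cotangentCompEquivOfIsLocalization_symm_comp_inl W Q P, LinearMap.comp_apply, LinearMap.inl_apply,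
    LinearEquiv.coe_toLinearMap]

/-- Under the splitting, the second projection is `J/J² ↠ K/K²`. [cite: Hartshorne2010, Ex. 3.5, p. 25] -/
theorem snd_comp_cotangentCompEquivOfIsLocalization :
    LinearMap.snd T (T ⊗[S] P.toExtension.Cotangent) Q.toExtension.Cotangent ∘ₗ
        (cotangentCompEquivOfIsLocalization W Q P).toLinearMap =
      Extension.Cotangent.map (Q.ofComp P).toExtensionHom :=
  ((Generators.Cotangent.exact Q P).splitSurjectiveEquiv
    (liftBaseChange_injective_of_isLocalization W Q P)
    ⟨cotangentCompSecOfIsLocalization W Q P, map_ofComp_comp_cotangentCompSecOfIsLocalization W Q P⟩).2.2.symm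

/-- Under the splitting, `I/I² → J/J²` is `x ↦ (1 ⊗ x, 0)`. [cite: Hartshorne2010, Ex. 3.5, p. 25] -/
theorem cotangentCompEquivOfIsLocalization_map_toComp (x : P.toExtension.Cotangent) :
    cotangentCompEquivOfIsLocalization W Q P (Extension.Cotangent.map (Q.toComp P).toExtensionHom x) =
      ((1 : T) ⊗ₜ[S] x, 0) := by
  rw [← LinearEquiv.eq_symm_apply, cotangentCompEquivOfIsLocalization_symm_inl, LinearMap.liftBaseChange_tmul,
    one_smul]

end Splitting

end Literature.AlgebraicGeometry.Deformation.LichtenbaumSchlessinger
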